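import Summits.Langlands.Langlands.Theorems.SqrtFiveQuarticCoversCartanIdentification

/-!
# The `(trace, det)` tables of `H8` and `H12 ≤ GL₂(𝔽₅)` — the one-Frobenius criterion against the
# refined locus, kernel-checked (CENSUS §3, E11)

Route `Langlands/SqrtFiveQuarticCovers` (cell `pub/lg-quartmod`, F-L1).  For an elliptic curve `E`
over a number field `K ∋ √5` the mod-`5` image `G = ρ̄_{E,5}(Γ_K)` has `det G ⊆ {±1}`; the route's
refined locus (`RefinedLocusModular`) is `G` conjugate into
`H8 = ⟨diag(2,3), antidiag(1,1)⟩` or into `H12 = ⟨(3 1;3 3), diag(1,4)⟩`.  The cell's per-point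
verdicts (E11, eng-5 R5-6B, eng-8) certify "image ⊄ any conjugate of H8 / H12" from ONE Frobenius
element: `N𝔓 ≡ 4 (mod 5)` (so `det ρ̄(Frob_𝔓) = -1`) with `a_𝔓(E) ≢ 0 (mod 5)`.  This file is the
kernel-checked group theory behind that criterion — the `(trace, det)` tables of the two groups:

* `H8`:  `{(0, 1), (2, 1), (3, 1), (0, -1)}` — `trace_eq_zero_of_mem_H8`,
  `trace_mem_of_mem_H8_of_det_eq_one`, sharpness `exists_mem_H8_trace_det`;
* `H12`: `{(1, 1), (2, 1), (3, 1), (4, 1), (0, -1)}` — `trace_eq_zero_of_mem_H12`,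
  `trace_ne_zero_of_mem_H12_of_det_eq_one`, sharpness `exists_mem_H12_trace_det`;
* in both groups every element of determinant `-1` is an INVOLUTION
  (`mul_self_eq_one_of_mem_H8`, `mul_self_eq_one_of_mem_H12`);
* conjugacy-proof forms, phrased on the conclusion of the route's census `GroupCensusFive`
  ("`∃ x, (∀ g ∈ G, x g x⁻¹ ∈ H8) ∨ (∀ g ∈ G, x g x⁻¹ ∈ H12)`"):
  `trace_eq_zero_of_conj_H8_or_H12` and the kill-lemmas `not_conj_H8_or_H12_of_witness`
  (`g ∈ G`, `det g = -1`, `trace g ≠ 0`), `not_conj_H12_of_witness_det_one` (`det g = 1`,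
  `trace g = 0`), `not_conj_H8_of_witness_det_one` (`det g = 1`, `trace g = ±1`);
* twist-proofness: `-1 ∈ H8`, `-1 ∈ H12` (`neg_one_mem_H8`, `neg_one_mem_H12`), so the tables are
  symmetric under `g ↦ -g` and the criteria survive quadratic twisting (`trace ↦ ± trace`).

Finite group theory only (entries of `2 × 2` matrices over `ZMod 5`, every residual check a `decide`
over at most three elements of `ZMod 5`); no definitions; standard axioms.  Nothing here is a
statement about elliptic curves or modularity: turning `(N𝔓 mod 5, a_𝔓 mod 5)` into
`(det, trace)` of `ρ̄(Frob_𝔓)` is the user's (standard) input.  References: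
[FreitasLeHungSiksek2015] Remark (iii) after Cor. 2.1 (the groups); CENSUS.md §3 of the cell.
-/

set_option linter.dupNamespace false -- project-wide option (lakefile weak.linter.dupNamespace); `Summit.Langlands.Langlands` is the mandated namespace

namespace Summit.Langlands.Langlands.Theorems.GroupCensusFive

open Matrix

/-! ## 1. `H8` -/

/-- **`H8`, determinant `-1` ⇒ trace `0`.** Every element of `H8 = ⟨diag(2,3), antidiag(1,1)⟩` of
determinant `-1` is antidiagonal, hence has trace `0`. [folklore] -/
theorem trace_eq_zero_of_mem_H8 {g : GL (Fin 2) (ZMod 5)}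
    (hg : g ∈ Subgroup.closure ({(⟨!![2, 0; 0, 3], !![3, 0; 0, 2], by decide, by decide⟩ : GL (Fin 2) (ZMod 5)),
      (⟨!![0, 1; 1, 0], !![0, 1; 1, 0], by decide, by decide⟩ : GL (Fin 2) (ZMod 5))} :
        Set (GL (Fin 2) (ZMod 5))))
    (hd : Matrix.det (g : Matrix (Fin 2) (Fin 2) (ZMod 5)) = -1) :
    Matrix.trace (g : Matrix (Fin 2) (Fin 2) (ZMod 5)) = 0 := by
  rcases (mem_H8_iff g).1 hg with ⟨-, -, h1⟩ | ⟨h00, h11, -⟩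
  · rw [hd] at h1; exact absurd h1 (by decide)
  · rw [Matrix.trace_fin_two, h00, h11, add_zero]

/-- **`H8`, determinant `1` ⇒ trace `∈ {0, 2, 3}`.** The determinant-one elements of `H8` are the
diagonal `diag(u, u⁻¹)`, `u ∈ 𝔽₅ˣ`, of traces `u + u⁻¹ ∈ {2, 3, 0, 0}`; in particular the trace is
never `±1`. [folklore] -/
theorem trace_mem_of_mem_H8_of_det_eq_one {g : GL (Fin 2) (ZMod 5)}
    (hg : g ∈ Subgroup.closure ({(⟨!![2, 0; 0, 3], !![3, 0; 0, 2], by decide, by decide⟩ : GL (Fin 2) (ZMod 5)),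
      (⟨!![0, 1; 1, 0], !![0, 1; 1, 0], by decide, by decide⟩ : GL (Fin 2) (ZMod 5))} :
        Set (GL (Fin 2) (ZMod 5))))
    (hd : Matrix.det (g : Matrix (Fin 2) (Fin 2) (ZMod 5)) = 1) :
    Matrix.trace (g : Matrix (Fin 2) (Fin 2) (ZMod 5)) = 0 ∨
      Matrix.trace (g : Matrix (Fin 2) (Fin 2) (ZMod 5)) = 2 ∨
      Matrix.trace (g : Matrix (Fin 2) (Fin 2) (ZMod 5)) = 3 := by
  obtain ⟨h01, h10⟩ := (mem_H8_iff_of_det_eq_one g hd).1 hg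
  obtain ⟨p, q, r, s, hm⟩ := exists_eq_fin_two (g : Matrix (Fin 2) (Fin 2) (ZMod 5))
  rw [hm] at h01 h10 hd ⊢
  rw [Matrix.det_fin_two_of] at hd
  rw [Matrix.trace_fin_two_of]
  simp only [Matrix.of_apply, Matrix.cons_val', Matrix.cons_val_zero, Matrix.cons_val_one,
    Matrix.cons_val_fin_one, Matrix.empty_val'] at h01 h10
  subst h01 h10
  clear hm hg
  revert p s hd; decide

/-- **`H8`: the determinant `-1` elements are involutions** (antidiagonal `antidiag(x, x⁻¹)`).
[folklore] -/
theorem mul_self_eq_one_of_mem_H8 {g : GL (Fin 2) (ZMod 5)}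
    (hg : g ∈ Subgroup.closure ({(⟨!![2, 0; 0, 3], !![3, 0; 0, 2], by decide, by decide⟩ : GL (Fin 2) (ZMod 5)),
      (⟨!![0, 1; 1, 0], !![0, 1; 1, 0], by decide, by decide⟩ : GL (Fin 2) (ZMod 5))} :
        Set (GL (Fin 2) (ZMod 5))))
    (hd : Matrix.det (g : Matrix (Fin 2) (Fin 2) (ZMod 5)) = -1) : g * g = 1 :=
  mul_self_eq_one_of_trace_zero g (trace_eq_zero_of_mem_H8 hg hd) hd

/-- **Sharpness of the `H8` table**: each of `(0, 1)`, `(2, 1)`, `(3, 1)`, `(0, -1)` is the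
`(trace, det)` of an element of `H8` (`diag(2,3)`, `1`, `-1`, `antidiag(1,1)`), and these are all
(`trace_eq_zero_of_mem_H8`, `trace_mem_of_mem_H8_of_det_eq_one`, `det H8 ⊆ {±1}`). [folklore] -/
theorem exists_mem_H8_trace_det (t d : ZMod 5) :
    (∃ g ∈ Subgroup.closure ({(⟨!![2, 0; 0, 3], !![3, 0; 0, 2], by decide, by decide⟩ : GL (Fin 2) (ZMod 5)),
      (⟨!![0, 1; 1, 0], !![0, 1; 1, 0], by decide, by decide⟩ : GL (Fin 2) (ZMod 5))} :
        Set (GL (Fin 2) (ZMod 5))),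
      Matrix.trace (g : Matrix (Fin 2) (Fin 2) (ZMod 5)) = t ∧
        Matrix.det (g : Matrix (Fin 2) (Fin 2) (ZMod 5)) = d) ↔
    ((t = 0 ∧ d = 1) ∨ (t = 2 ∧ d = 1) ∨ (t = 3 ∧ d = 1) ∨ (t = 0 ∧ d = -1)) := by
  constructor
  · rintro ⟨g, hg, rfl, rfl⟩
    rcases (mem_H8_iff g).1 hg with ⟨-, -, h1⟩ | ⟨-, -, h1⟩
    · rcases trace_mem_of_mem_H8_of_det_eq_one hg h1 with h | h | h
      · exact Or.inl ⟨h, h1⟩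
      · exact Or.inr (Or.inl ⟨h, h1⟩)
      · exact Or.inr (Or.inr (Or.inl ⟨h, h1⟩))
    · exact Or.inr (Or.inr (Or.inr ⟨trace_eq_zero_of_mem_H8 hg h1, h1⟩))
  · rintro (⟨rfl, rfl⟩ | ⟨rfl, rfl⟩ | ⟨rfl, rfl⟩ | ⟨rfl, rfl⟩)
    · refine ⟨⟨!![2, 0; 0, 3], !![3, 0; 0, 2], by decide, by decide⟩, mem_H8_of_shape _ (Or.inl ?_), ?_, ?_⟩
      · exact ⟨rfl, rfl, by rw [Matrix.det_fin_two_of]; decide⟩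
      · rw [Matrix.trace_fin_two_of]; decide
      · rw [Matrix.det_fin_two_of]; decide
    · refine ⟨1, Subgroup.one_mem _, ?_, ?_⟩
      · rw [Units.val_one, Matrix.trace_one, Fintype.card_fin]; decide
      · rw [Units.val_one, Matrix.det_one]
    · refine ⟨⟨!![4, 0; 0, 4], !![4, 0; 0, 4], by decide, by decide⟩, mem_H8_of_shape _ (Or.inl ?_), ?_, ?_⟩
      · exact ⟨rfl, rfl, by rw [Matrix.det_fin_two_of]; decide⟩
      · rw [Matrix.trace_fin_two_of]; decide
      · rw [Matrix.det_fin_two_of]; decide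
    · refine ⟨⟨!![0, 1; 1, 0], !![0, 1; 1, 0], by decide, by decide⟩, mem_H8_of_shape _ (Or.inr ?_), ?_, ?_⟩
      · exact ⟨rfl, rfl, by rw [Matrix.det_fin_two_of]; decide⟩
      · rw [Matrix.trace_fin_two_of]; decide
      · rw [Matrix.det_fin_two_of]; decide

/-- `-1 ∈ H8` (`= diag(4,4) = diag(2,3)²`): the `H8` table is symmetric under `g ↦ -g`, so the
criteria below are unchanged by a quadratic twist of the representation. [folklore] -/
theorem neg_one_mem_H8 :
    (⟨!![4, 0; 0, 4], !![4, 0; 0, 4], by decide, by decide⟩ : GL (Fin 2) (ZMod 5)) ∈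
      Subgroup.closure ({(⟨!![2, 0; 0, 3], !![3, 0; 0, 2], by decide, by decide⟩ : GL (Fin 2) (ZMod 5)),
        (⟨!![0, 1; 1, 0], !![0, 1; 1, 0], by decide, by decide⟩ : GL (Fin 2) (ZMod 5))} :
          Set (GL (Fin 2) (ZMod 5))) :=
  mem_H8_of_shape _ (Or.inl ⟨rfl, rfl, by rw [Matrix.det_fin_two_of]; decide⟩)

/-! ## 2. `H12` -/

/-- **`H12`, determinant `-1` ⇒ trace `0`.** An element of `H12 = ⟨a, f⟩`, `a = (3 1;3 3)`,
`f = diag(1,4)`, of determinant `-1` lies in the Frobenius coset `C₆ f` (`g a g⁻¹ = a⁻¹`), and every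
`g` with `g a = a⁻¹ g` has the shape `(−s 3r; r s)`, trace `0`. [folklore] -/
theorem trace_eq_zero_of_mem_H12 {g : GL (Fin 2) (ZMod 5)}
    (hg : g ∈ Subgroup.closure ({(⟨!![3, 1; 3, 3], !![3, 4; 2, 3], by decide, by decide⟩ : GL (Fin 2) (ZMod 5)),
      (⟨!![1, 0; 0, 4], !![1, 0; 0, 4], by decide, by decide⟩ : GL (Fin 2) (ZMod 5))} : Set (GL (Fin 2) (ZMod 5))))
    (hd : Matrix.det (g : Matrix (Fin 2) (Fin 2) (ZMod 5)) = -1) :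
    Matrix.trace (g : Matrix (Fin 2) (Fin 2) (ZMod 5)) = 0 := by
  rcases (mem_H12_iff g).1 hg with ⟨-, h1⟩ | ⟨hc, -⟩
  · rw [hd] at h1; exact absurd h1 (by decide)
  · obtain ⟨p, q, r, s, hm⟩ := exists_eq_fin_two (g : Matrix (Fin 2) (Fin 2) (ZMod 5))
    rw [hm] at hc ⊢
    have h01 := congrArg (fun m : Matrix (Fin 2) (Fin 2) (ZMod 5) => m 0 1) hc
    simp only [Matrix.mul_fin_two, Matrix.of_apply, Matrix.cons_val', Matrix.cons_val_zero,
      Matrix.cons_val_one, Matrix.cons_val_fin_one, Matrix.empty_val'] at h01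
    rw [Matrix.trace_fin_two_of]
    clear hc hm hg hd
    revert p q s h01; decide

/-- **`H12`, determinant `1` ⇒ trace `≠ 0`** (the determinant-one part of `H12` is
`C₆ = {±1, ±a, ±a²} ⊂ 𝔽₅[a]ˣ`, traces `2, 3, 1, 4, 4, 1`): an element commuting with `a = (3 1;3 3)`
has the shape `(p q; 3q p)` (`= (p - 3q)·1 + q·a ∈ 𝔽₅[a]`), of trace `2p` and determinant
`p² - 3q²`, and `p = 0` would force `q² = 3`, a non-square mod `5`. [folklore] -/
theorem trace_ne_zero_of_mem_H12_of_det_eq_one {g : GL (Fin 2) (ZMod 5)}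
    (hg : g ∈ Subgroup.closure ({(⟨!![3, 1; 3, 3], !![3, 4; 2, 3], by decide, by decide⟩ : GL (Fin 2) (ZMod 5)),
      (⟨!![1, 0; 0, 4], !![1, 0; 0, 4], by decide, by decide⟩ : GL (Fin 2) (ZMod 5))} : Set (GL (Fin 2) (ZMod 5))))
    (hd : Matrix.det (g : Matrix (Fin 2) (Fin 2) (ZMod 5)) = 1) :
    Matrix.trace (g : Matrix (Fin 2) (Fin 2) (ZMod 5)) ≠ 0 := by
  have hc := (mem_H12_iff_of_det_eq_one g hd).1 hg
  obtain ⟨p, q, r, s, hm⟩ := exists_eq_fin_two (g : Matrix (Fin 2) (Fin 2) (ZMod 5))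
  rw [hm] at hc hd ⊢
  have h00 := congrArg (fun m : Matrix (Fin 2) (Fin 2) (ZMod 5) => m 0 0) hc
  have h01 := congrArg (fun m : Matrix (Fin 2) (Fin 2) (ZMod 5) => m 0 1) hc
  simp only [Matrix.mul_fin_two, Matrix.of_apply, Matrix.cons_val', Matrix.cons_val_zero,
    Matrix.cons_val_one, Matrix.cons_val_fin_one, Matrix.empty_val'] at h00 h01
  rw [Matrix.det_fin_two_of] at hd
  rw [Matrix.trace_fin_two_of]
  clear hc hm hg
  revert p q r s h00 h01 hd; decide

/-- **`H12`: the determinant `-1` elements are involutions** (the six reflections of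
`H12 ≅ D₆`). [folklore] -/
theorem mul_self_eq_one_of_mem_H12 {g : GL (Fin 2) (ZMod 5)}
    (hg : g ∈ Subgroup.closure ({(⟨!![3, 1; 3, 3], !![3, 4; 2, 3], by decide, by decide⟩ : GL (Fin 2) (ZMod 5)),
      (⟨!![1, 0; 0, 4], !![1, 0; 0, 4], by decide, by decide⟩ : GL (Fin 2) (ZMod 5))} : Set (GL (Fin 2) (ZMod 5))))
    (hd : Matrix.det (g : Matrix (Fin 2) (Fin 2) (ZMod 5)) = -1) : g * g = 1 :=
  mul_self_eq_one_of_trace_zero g (trace_eq_zero_of_mem_H12 hg hd) hd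

/-- **Sharpness of the `H12` table**: each of `(1, 1)`, `(2, 1)`, `(3, 1)`, `(4, 1)`, `(0, -1)` is
the `(trace, det)` of an element of `H12` (`a`, `1`, `a³ = -1`, `a² = (2 1;3 2)`, `f`), and these
are all (`trace_eq_zero_of_mem_H12`, `trace_ne_zero_of_mem_H12_of_det_eq_one`, `det H12 ⊆ {±1}`).
[folklore] -/
theorem exists_mem_H12_trace_det (t d : ZMod 5) :
    (∃ g ∈ Subgroup.closure ({(⟨!![3, 1; 3, 3], !![3, 4; 2, 3], by decide, by decide⟩ : GL (Fin 2) (ZMod 5)),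
      (⟨!![1, 0; 0, 4], !![1, 0; 0, 4], by decide, by decide⟩ : GL (Fin 2) (ZMod 5))} : Set (GL (Fin 2) (ZMod 5))),
      Matrix.trace (g : Matrix (Fin 2) (Fin 2) (ZMod 5)) = t ∧
        Matrix.det (g : Matrix (Fin 2) (Fin 2) (ZMod 5)) = d) ↔
    ((t ≠ 0 ∧ d = 1) ∨ (t = 0 ∧ d = -1)) := by
  constructor
  · rintro ⟨g, hg, rfl, rfl⟩
    rcases (mem_H12_iff g).1 hg with ⟨-, h1⟩ | ⟨-, h1⟩
    · exact Or.inl ⟨trace_ne_zero_of_mem_H12_of_det_eq_one hg h1, h1⟩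
    · exact Or.inr ⟨trace_eq_zero_of_mem_H12 hg h1, h1⟩
  · rintro (⟨ht, rfl⟩ | ⟨rfl, rfl⟩)
    · -- the four non-zero traces: `a` (1), `1` (2), `-1` (3), `a²` (4)
      have key : ∀ u : GL (Fin 2) (ZMod 5),
          (u : Matrix (Fin 2) (Fin 2) (ZMod 5)) * !![3, 1; 3, 3] = !![3, 1; 3, 3] * (u : Matrix (Fin 2) (Fin 2) (ZMod 5)) →
          Matrix.det (u : Matrix (Fin 2) (Fin 2) (ZMod 5)) = 1 →
          ∃ g ∈ Subgroup.closure ({(⟨!![3, 1; 3, 3], !![3, 4; 2, 3], by decide, by decide⟩ : GL (Fin 2) (ZMod 5)),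
            (⟨!![1, 0; 0, 4], !![1, 0; 0, 4], by decide, by decide⟩ : GL (Fin 2) (ZMod 5))} : Set (GL (Fin 2) (ZMod 5))),
            Matrix.trace (g : Matrix (Fin 2) (Fin 2) (ZMod 5)) = Matrix.trace (u : Matrix (Fin 2) (Fin 2) (ZMod 5)) ∧
              Matrix.det (g : Matrix (Fin 2) (Fin 2) (ZMod 5)) = 1 :=
        fun u hu hdu => ⟨u, mem_H12_of_shape u (Or.inl ⟨hu, hdu⟩), rfl, hdu⟩
      have h1 := key ⟨!![3, 1; 3, 3], !![3, 4; 2, 3], by decide, by decide⟩ (by decide)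
        (by rw [Matrix.det_fin_two_of]; decide)
      have h2 := key 1 (by rw [Units.val_one, Matrix.one_mul, Matrix.mul_one])
        (by rw [Units.val_one, Matrix.det_one])
      have h3 := key ⟨!![4, 0; 0, 4], !![4, 0; 0, 4], by decide, by decide⟩ (by decide)
        (by rw [Matrix.det_fin_two_of]; decide)
      have h4 := key ⟨!![2, 1; 3, 2], !![2, 4; 2, 2], by decide, by decide⟩ (by decide)
        (by rw [Matrix.det_fin_two_of]; decide)
      have e1 : Matrix.trace ((⟨!![3, 1; 3, 3], !![3, 4; 2, 3], by decide, by decide⟩ : GL (Fin 2) (ZMod 5)) :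
          Matrix (Fin 2) (Fin 2) (ZMod 5)) = 1 := by
        change Matrix.trace (!![3, 1; 3, 3] : Matrix (Fin 2) (Fin 2) (ZMod 5)) = 1
        rw [Matrix.trace_fin_two_of]; decide
      have e2 : Matrix.trace ((1 : GL (Fin 2) (ZMod 5)) : Matrix (Fin 2) (Fin 2) (ZMod 5)) = 2 := by
        rw [Units.val_one, Matrix.trace_one, Fintype.card_fin]; decide
      have e3 : Matrix.trace ((⟨!![4, 0; 0, 4], !![4, 0; 0, 4], by decide, by decide⟩ : GL (Fin 2) (ZMod 5)) :
          Matrix (Fin 2) (Fin 2) (ZMod 5)) = 3 := by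
        change Matrix.trace (!![4, 0; 0, 4] : Matrix (Fin 2) (Fin 2) (ZMod 5)) = 3
        rw [Matrix.trace_fin_two_of]; decide
      have e4 : Matrix.trace ((⟨!![2, 1; 3, 2], !![2, 4; 2, 2], by decide, by decide⟩ : GL (Fin 2) (ZMod 5)) :
          Matrix (Fin 2) (Fin 2) (ZMod 5)) = 4 := by
        change Matrix.trace (!![2, 1; 3, 2] : Matrix (Fin 2) (Fin 2) (ZMod 5)) = 4
        rw [Matrix.trace_fin_two_of]; decide
      rw [e1] at h1; rw [e2] at h2; rw [e3] at h3; rw [e4] at h4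
      have ht' : t = 1 ∨ t = 2 ∨ t = 3 ∨ t = 4 := by revert t; decide
      rcases ht' with rfl | rfl | rfl | rfl
      exacts [h1, h2, h3, h4]
    · refine ⟨⟨!![1, 0; 0, 4], !![1, 0; 0, 4], by decide, by decide⟩, mem_H12_of_shape _ (Or.inr ⟨by decide, ?_⟩), ?_, ?_⟩
      · rw [Matrix.det_fin_two_of]; decide
      · change Matrix.trace (!![1, 0; 0, 4] : Matrix (Fin 2) (Fin 2) (ZMod 5)) = 0
        rw [Matrix.trace_fin_two_of]; decide
      · change Matrix.det (!![1, 0; 0, 4] : Matrix (Fin 2) (Fin 2) (ZMod 5)) = -1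
        rw [Matrix.det_fin_two_of]; decide

/-- `-1 ∈ H12` (`= a³`): the `H12` table is symmetric under `g ↦ -g`, so the criteria below are
unchanged by a quadratic twist of the representation. [folklore] -/
theorem neg_one_mem_H12 :
    (⟨!![4, 0; 0, 4], !![4, 0; 0, 4], by decide, by decide⟩ : GL (Fin 2) (ZMod 5)) ∈
      Subgroup.closure ({(⟨!![3, 1; 3, 3], !![3, 4; 2, 3], by decide, by decide⟩ : GL (Fin 2) (ZMod 5)),
        (⟨!![1, 0; 0, 4], !![1, 0; 0, 4], by decide, by decide⟩ : GL (Fin 2) (ZMod 5))} : Set (GL (Fin 2) (ZMod 5))) :=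
  mem_H12_of_shape _ (Or.inl ⟨by decide, by rw [Matrix.det_fin_two_of]; decide⟩)

/-! ## 3. Conjugacy-proof forms (on the conclusion of `GroupCensusFive`) and the kill-lemmas -/

/-- **Determinant `-1` ⇒ trace `0` on the whole refined locus.** If `G ≤ GL₂(𝔽₅)` is conjugate into
`H8` or into `H12` (the conclusion of the census `GroupCensusFive`), then every `g ∈ G` of
determinant `-1` has trace `0` (trace and determinant are conjugation invariants). [folklore] -/
theorem trace_eq_zero_of_conj_H8_or_H12 {G : Subgroup (GL (Fin 2) (ZMod 5))}
    (h : ∃ x : GL (Fin 2) (ZMod 5),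
      (∀ g ∈ G, x * g * x⁻¹ ∈ Subgroup.closure ({(⟨!![2, 0; 0, 3], !![3, 0; 0, 2], by decide, by decide⟩ : GL (Fin 2) (ZMod 5)), (⟨!![0, 1; 1, 0], !![0, 1; 1, 0], by decide, by decide⟩ : GL (Fin 2) (ZMod 5))} : Set (GL (Fin 2) (ZMod 5)))) ∨
      (∀ g ∈ G, x * g * x⁻¹ ∈ Subgroup.closure ({(⟨!![3, 1; 3, 3], !![3, 4; 2, 3], by decide, by decide⟩ : GL (Fin 2) (ZMod 5)), (⟨!![1, 0; 0, 4], !![1, 0; 0, 4], by decide, by decide⟩ : GL (Fin 2) (ZMod 5))} : Set (GL (Fin 2) (ZMod 5))))) :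
    ∀ g ∈ G, Matrix.det ((g : GL (Fin 2) (ZMod 5)) : Matrix (Fin 2) (Fin 2) (ZMod 5)) = -1 →
      Matrix.trace ((g : GL (Fin 2) (ZMod 5)) : Matrix (Fin 2) (Fin 2) (ZMod 5)) = 0 := by
  intro g hg hd
  obtain ⟨x, hx⟩ := h
  have hd' : Matrix.det ((x * g * x⁻¹ : GL (Fin 2) (ZMod 5)) : Matrix (Fin 2) (Fin 2) (ZMod 5)) = -1 := by
    rw [Units.val_mul, Units.val_mul, Matrix.det_units_conj]; exact hd
  have key : Matrix.trace ((x * g * x⁻¹ : GL (Fin 2) (ZMod 5)) : Matrix (Fin 2) (Fin 2) (ZMod 5)) = 0 := by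
    rcases hx with hx | hx
    · exact trace_eq_zero_of_mem_H8 (hx g hg) hd'
    · exact trace_eq_zero_of_mem_H12 (hx g hg) hd'
  rwa [Units.val_mul, Units.val_mul, Matrix.trace_units_conj] at key

/-- **The one-element kill-lemma (E11 criterion).** A subgroup `G ≤ GL₂(𝔽₅)` containing an element
of determinant `-1` and NON-ZERO trace is conjugate neither into `H8` nor into `H12`.  (For
`G = ρ̄_{E,5}(Γ_K)`: one prime `𝔓` of good reduction with `N𝔓 ≡ 4 (mod 5)` and
`a_𝔓(E) ≢ 0 (mod 5)`.) [folklore] -/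
theorem not_conj_H8_or_H12_of_witness {G : Subgroup (GL (Fin 2) (ZMod 5))} {g : GL (Fin 2) (ZMod 5)}
    (hg : g ∈ G) (hd : Matrix.det (g : Matrix (Fin 2) (Fin 2) (ZMod 5)) = -1)
    (ht : Matrix.trace (g : Matrix (Fin 2) (Fin 2) (ZMod 5)) ≠ 0) :
    ¬ ∃ x : GL (Fin 2) (ZMod 5),
      (∀ g ∈ G, x * g * x⁻¹ ∈ Subgroup.closure ({(⟨!![2, 0; 0, 3], !![3, 0; 0, 2], by decide, by decide⟩ : GL (Fin 2) (ZMod 5)), (⟨!![0, 1; 1, 0], !![0, 1; 1, 0], by decide, by decide⟩ : GL (Fin 2) (ZMod 5))} : Set (GL (Fin 2) (ZMod 5)))) ∨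
      (∀ g ∈ G, x * g * x⁻¹ ∈ Subgroup.closure ({(⟨!![3, 1; 3, 3], !![3, 4; 2, 3], by decide, by decide⟩ : GL (Fin 2) (ZMod 5)), (⟨!![1, 0; 0, 4], !![1, 0; 0, 4], by decide, by decide⟩ : GL (Fin 2) (ZMod 5))} : Set (GL (Fin 2) (ZMod 5)))) :=
  fun h => ht (trace_eq_zero_of_conj_H8_or_H12 h g hg hd)

/-- **Kill-lemma against `H12` at determinant `1`.** A subgroup containing an element of
determinant `1` and trace `0` is not conjugate into `H12` (for `ρ̄_{E,5}`: a good prime with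
`N𝔓 ≡ 1 (mod 5)` and `a_𝔓(E) ≡ 0 (mod 5)`). [folklore] -/
theorem not_conj_H12_of_witness_det_one {G : Subgroup (GL (Fin 2) (ZMod 5))} {g : GL (Fin 2) (ZMod 5)}
    (hg : g ∈ G) (hd : Matrix.det (g : Matrix (Fin 2) (Fin 2) (ZMod 5)) = 1)
    (ht : Matrix.trace (g : Matrix (Fin 2) (Fin 2) (ZMod 5)) = 0) :
    ¬ ∃ x : GL (Fin 2) (ZMod 5), ∀ g ∈ G, x * g * x⁻¹ ∈
      Subgroup.closure ({(⟨!![3, 1; 3, 3], !![3, 4; 2, 3], by decide, by decide⟩ : GL (Fin 2) (ZMod 5)), (⟨!![1, 0; 0, 4], !![1, 0; 0, 4], by decide, by decide⟩ : GL (Fin 2) (ZMod 5))} : Set (GL (Fin 2) (ZMod 5))) := by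
  rintro ⟨x, hx⟩
  have hd' : Matrix.det ((x * g * x⁻¹ : GL (Fin 2) (ZMod 5)) : Matrix (Fin 2) (Fin 2) (ZMod 5)) = 1 := by
    rw [Units.val_mul, Units.val_mul, Matrix.det_units_conj]; exact hd
  refine trace_ne_zero_of_mem_H12_of_det_eq_one (hx g hg) hd' ?_
  rw [Units.val_mul, Units.val_mul, Matrix.trace_units_conj]; exact ht

/-- **Kill-lemma against `H8` at determinant `1`.** A subgroup containing an element of determinant
`1` and trace `±1` is not conjugate into `H8` (for `ρ̄_{E,5}`: a good prime with `N𝔓 ≡ 1 (mod 5)`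
and `a_𝔓(E) ≡ ±1 (mod 5)`). [folklore] -/
theorem not_conj_H8_of_witness_det_one {G : Subgroup (GL (Fin 2) (ZMod 5))} {g : GL (Fin 2) (ZMod 5)}
    (hg : g ∈ G) (hd : Matrix.det (g : Matrix (Fin 2) (Fin 2) (ZMod 5)) = 1)
    (ht : Matrix.trace (g : Matrix (Fin 2) (Fin 2) (ZMod 5)) = 1 ∨
      Matrix.trace (g : Matrix (Fin 2) (Fin 2) (ZMod 5)) = 4) :
    ¬ ∃ x : GL (Fin 2) (ZMod 5), ∀ g ∈ G, x * g * x⁻¹ ∈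
      Subgroup.closure ({(⟨!![2, 0; 0, 3], !![3, 0; 0, 2], by decide, by decide⟩ : GL (Fin 2) (ZMod 5)), (⟨!![0, 1; 1, 0], !![0, 1; 1, 0], by decide, by decide⟩ : GL (Fin 2) (ZMod 5))} : Set (GL (Fin 2) (ZMod 5))) := by
  rintro ⟨x, hx⟩
  have hd' : Matrix.det ((x * g * x⁻¹ : GL (Fin 2) (ZMod 5)) : Matrix (Fin 2) (Fin 2) (ZMod 5)) = 1 := by
    rw [Units.val_mul, Units.val_mul, Matrix.det_units_conj]; exact hd
  have key := trace_mem_of_mem_H8_of_det_eq_one (hx g hg) hd'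
  rw [Units.val_mul, Units.val_mul, Matrix.trace_units_conj] at key
  rcases ht with ht | ht <;> rw [ht] at key <;> revert key <;> decide

/-- **Both kill-lemmas at determinant `1` together**: an element of determinant `1` in a subgroup
conjugate into `H8` or `H12` has trace `≠ ±1` in the first case and `≠ 0` in the second; so a
determinant-one element of trace `0` excludes `H12` and one of trace `±1` excludes `H8` — given
both kinds of elements, `G` is outside the refined locus. [folklore] -/
theorem not_conj_H8_or_H12_of_witnesses_det_one {G : Subgroup (GL (Fin 2) (ZMod 5))}
    {g g' : GL (Fin 2) (ZMod 5)} (hg : g ∈ G) (hg' : g' ∈ G)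
    (hd : Matrix.det (g : Matrix (Fin 2) (Fin 2) (ZMod 5)) = 1)
    (ht : Matrix.trace (g : Matrix (Fin 2) (Fin 2) (ZMod 5)) = 1 ∨
      Matrix.trace (g : Matrix (Fin 2) (Fin 2) (ZMod 5)) = 4)
    (hd' : Matrix.det (g' : Matrix (Fin 2) (Fin 2) (ZMod 5)) = 1)
    (ht' : Matrix.trace (g' : Matrix (Fin 2) (Fin 2) (ZMod 5)) = 0) :
    ¬ ∃ x : GL (Fin 2) (ZMod 5),
      (∀ g ∈ G, x * g * x⁻¹ ∈ Subgroup.closure ({(⟨!![2, 0; 0, 3], !![3, 0; 0, 2], by decide, by decide⟩ : GL (Fin 2) (ZMod 5)), (⟨!![0, 1; 1, 0], !![0, 1; 1, 0], by decide, by decide⟩ : GL (Fin 2) (ZMod 5))} : Set (GL (Fin 2) (ZMod 5)))) ∨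
      (∀ g ∈ G, x * g * x⁻¹ ∈ Subgroup.closure ({(⟨!![3, 1; 3, 3], !![3, 4; 2, 3], by decide, by decide⟩ : GL (Fin 2) (ZMod 5)), (⟨!![1, 0; 0, 4], !![1, 0; 0, 4], by decide, by decide⟩ : GL (Fin 2) (ZMod 5))} : Set (GL (Fin 2) (ZMod 5)))) := by
  rintro ⟨x, hx | hx⟩
  · exact not_conj_H8_of_witness_det_one hg hd ht ⟨x, hx⟩
  · exact not_conj_H12_of_witness_det_one hg' hd' ht' ⟨x, hx⟩

end Summit.Langlands.Langlands.Theorems.GroupCensusFive
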